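import Mathlib
import Summits.ValiantsHypothesis.ValiantsHypothesis.Theorems.RigidityForcesSymmetryRankRigidMinimalReprLaplaceDual
import Summits.ValiantsHypothesis.ValiantsHypothesis.Theorems.RigidityForcesSymmetryRankRigidMinimalReprLaplaceTriangular

/-!
# `LaplaceOptimalFive`, slice classes `a = 4`: four slices and one pair term never represent `P₅`
# (crux `RankRigidMinimalRepr`, stmt-ValiantsHypothesis-18034; frontier rung `LaplaceOptimalFive`, stmt-24813)

A cheap split-rank-one decomposition of the `5 × 5` permutation pattern (`24a + 12b ≤ 108`) with `a ≥ 4` slices has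
exactly four slices and at most one pair term (16 of the 1 618 maximal cheap profiles).  `four_slices_one_pair` refutes
every such shape for which the slots admit a TRIANGULAR ORDER: an order of the five slots with the pair's slot `p` before
`q` and, at position `j`, `#{slices at that slot} + [slot = q] + j ≤ 4`.  (Such an order exists for 14 of the 16
configurations — all except «one slice at each of four slots, pair through the fifth» and «slices 2+1+1 at three slots,
pair on the other two», which need the basis-row variant; see the evidence note NOTE-p8g10-24813 on the item.  The
order is an explicit hypothesis here, to be discharged by `decide` per configuration at assembly time.)

Proof: `LaplaceTriangular.triangular_witness` gives covectors `φ` killing the four slices (`φ_{i_k} ⊥ α_k`) and the pair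
(`Σ φ_p(a) u(a,b) φ_q(b) = 0`) with `per (φ_i(c)) ≠ 0`; `LaplaceDual.no_decomposition_of_witness` (with `kill_slice`,
`kill_pair`) turns that into the contradiction.  The slice vectors `α_k`, the cofactors `W_k`, the pair factors `u, w` are
ARBITRARY (zero allowed), so fewer slices / no pair term are covered.

HONEST FRAMING: an exact partial result toward the frontier rung `LaplaceOptimalFive` (stmt-24813), which stays OPEN
(the pair-heavy profiles are untouched); nothing here bears on `VP ≠ VNP`.
-/

set_option autoImplicit false

-- the mandated summit-side namespace repeats a component by design (single-problem summit)
set_option linter.dupNamespace false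

namespace Summit.ValiantsHypothesis.ValiantsHypothesis.Theorems.RigidityForcesSymmetryRankRigidMinimalRepr

namespace LaplaceFiveSlices

open Finset

/-- **Four slices + one pair term ≠ P₅ (triangular configurations).**  For slots `i : Fin 4 → Fin 5` of the slices
(vectors `α_k`, cofactors `W_k` blind to slot `i k`), a pair term `u(v_p, v_q) · w` (`w` blind to `p, q`), and an order
`ord` of the slots with `p` before `q` satisfying the count condition, the pattern `[v injective]` is NOT
`Σ_k α_k(v_{i k}) W_k(v) + u(v) w(v)`. -/
theorem four_slices_one_pair (i : Fin 4 → Fin 5) (α : Fin 4 → Fin 5 → ℂ) (W : Fin 4 → (Fin 5 → Fin 5) → ℂ)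
    (hW : ∀ k, ∀ v v' : Fin 5 → Fin 5, (∀ j, j ≠ i k → v j = v' j) → W k v = W k v')
    (p q : Fin 5) (u w : (Fin 5 → Fin 5) → ℂ)
    (hu : ∀ v v' : Fin 5 → Fin 5, v p = v' p → v q = v' q → u v = u v')
    (hw : ∀ v v' : Fin 5 → Fin 5, (∀ j, j ≠ p → j ≠ q → v j = v' j) → w v = w v')
    (ord : Equiv.Perm (Fin 5)) (hpq : ord.symm p < ord.symm q)
    (hcount : ∀ j : Fin 5,
      (univ.filter (fun k : Fin 4 => i k = ord j)).card + (if ord j = q then 1 else 0) + (j : ℕ) + 1 ≤ 5) :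
    ¬ ∀ v : Fin 5 → Fin 5,
      (if Function.Injective v then (1 : ℂ) else 0) = (∑ k, α k (v (i k)) * W k v) + u v * w v := by
  classical
  intro H
  have hpq' : p ≠ q := fun h => by rw [h] at hpq; exact lt_irrefl _ hpq
  -- the witness
  let A : Fin 5 → Finset (Fin 5 → ℂ) := fun s => (univ.filter (fun k : Fin 4 => i k = s)).image α
  let g : Fin 5 → Fin 5 → ℂ := fun a b => u (Function.update (Function.update (fun _ => (0 : Fin 5)) p a) q b)
  have hcount' : ∀ j : Fin 5, (A (ord j)).card + (if ord j = q then 1 else 0) + (j : ℕ) + 1 ≤ 5 := by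
    intro j
    have h1 : (A (ord j)).card ≤ (univ.filter (fun k : Fin 4 => i k = ord j)).card := card_image_le
    have h2 := hcount j
    omega
  obtain ⟨φ, hφA, hφg, hper⟩ := LaplaceTriangular.triangular_witness ord A p q hpq g hcount'
  -- the decomposition in the data format of `LaplaceOptimal 5`: terms `Fin 5` = four slices, then the pair
  let S : Fin 5 → Finset (Fin 5) := Fin.snoc (fun k : Fin 4 => ({i k} : Finset (Fin 5))) {p, q}
  let U : Fin 5 → (Fin 5 → Fin 5) → ℂ := Fin.snoc (fun (k : Fin 4) (v : Fin 5 → Fin 5) => α k (v (i k))) u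
  let V : Fin 5 → (Fin 5 → Fin 5) → ℂ := Fin.snoc W w
  have hS1 : ∀ k : Fin 4, S k.castSucc = {i k} := fun k => by simp [S]
  have hS2 : S (Fin.last 4) = {p, q} := Fin.snoc_last _ _
  have hU1 : ∀ k : Fin 4, U k.castSucc = fun v => α k (v (i k)) := fun k => by simp [U]
  have hU2 : U (Fin.last 4) = u := Fin.snoc_last _ _
  have hV1 : ∀ k : Fin 4, V k.castSucc = W k := fun k => by simp [V]
  have hV2 : V (Fin.last 4) = w := Fin.snoc_last _ _
  refine LaplaceDual.no_decomposition_of_witness (d := 5) (univ : Finset (Fin 5)) S U V ?_ ?_ 0 φ hper ?_ ?_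
  · -- `U t` sees only the slots of `S t`
    intro t v v' hvv'
    rcases Fin.eq_castSucc_or_eq_last t with ⟨k, rfl⟩ | rfl
    · rw [hU1]
      have := hvv' (i k) (by rw [hS1]; simp)
      simp [this]
    · rw [hU2]
      exact hu v v' (hvv' p (by rw [hS2]; simp)) (hvv' q (by rw [hS2]; simp))
  · -- `V t` is blind to the slots of `S t`
    intro t v v' hvv'
    rcases Fin.eq_castSucc_or_eq_last t with ⟨k, rfl⟩ | rfl
    · rw [hV1]
      exact hW k v v' (fun j hj => hvv' j (by rw [hS1]; simpa using hj))
    · rw [hV2]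
      exact hw v v' (fun j hjp hjq => hvv' j (by rw [hS2]; simp [hjp, hjq]))
  · -- every term is killed by `φ`
    intro t _
    rcases Fin.eq_castSucc_or_eq_last t with ⟨k, rfl⟩ | rfl
    · left
      rw [hS1, hU1]
      refine LaplaceDual.kill_slice (d := 5) 0 (i k) φ (fun v => α k (v (i k))) ?_
      have := hφA (i k) (α k) (by simp only [A, mem_image, mem_filter, mem_univ, true_and]; exact ⟨k, rfl, rfl⟩)
      simpa [Function.update_self] using this
    · left
      rw [hS2, hU2]
      exact LaplaceDual.kill_pair (d := 5) 0 p q hpq' φ u hφg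
  · -- the purported identity
    intro v
    rw [Fin.sum_univ_castSucc]
    simp only [hU1, hU2, hV1, hV2]
    exact (H v).symm

end LaplaceFiveSlices

end Summit.ValiantsHypothesis.ValiantsHypothesis.Theorems.RigidityForcesSymmetryRankRigidMinimalRepr
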